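import Literature.MathematicalPhysics.QuantumFieldTheory.BalabanImbrieJaffe1984to88.BIJ88RT51NoChange

/-!
# `BalabanImbrieJaffe1984to88.BIJ88RT51BlockGauge` — T. Bałaban, J. Imbrie, A. Jaffe, *Effective action and cluster properties of the
abelian Higgs model*, Commun. Math. Phys. **114** (1988) 257–315 [BalabanImbrieJaffe1988], (4.17) p. 277 [PDF 21] and (5.2.9) p. 279
[PDF 23]: **block field gauge COVARIANCE of the renormalization transformation (5.1.1) of the general step** — if the term densities
`ρ′_k` are invariant and the background kernels `Q(u_k)φ` covariant under the block field gauge transformations (4.17) (the earlier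
fields `u^{(j)}` reparametrized by a `Π𝒟u^{(j)}`-preserving map), then the block-gauge transform `(v, ψ) ↦ ρ̃(v^g, gψ)` of every density
`ρ̃` that (5.1.1) produces is again produced by (5.1.1) from the same data — the general-step companion of r18's one-step
`BIJ88BlockGauge417.isRT311_blockGauge` (file 3 of seat p34 gen 5; file 1 `BIJ88RT51GeneralStep` typed (5.1.1) as `IsRT511`/`IsRT511Ax`, file 2 `BIJ88RT51NoChange`).

statement-level skeleton of published theorems with citation tags; proofs where landed; nothing here is a claim about the Yang–Mills mass gap

PDF held: `paper:balaban1988-cmp114-bij-abelian-higgs-effective-action` (journal page = PDF page + 256); pp. 277–279 [PDF 21–23]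
read as images (r16's renders `HOME/lit-balaban-r16/renders/cmp114/original-p021-x2.png`, `original-p022-x2.png`; r18's crops of p. 277).

CITATION HEADER (lean-in-tree rule).  Part of the lit-balaban TYPED SKELETON (HOME `run/shared/lean/pub/lit-balaban/`), PHASE-2 proof
seat p34 gen 5 (unit `lit-balaban-p34-g5`; TAKING line HOME/STATUS.md 2026-08-21T06:5xZ, free-target protocol G.5-34(d), own lineage =
the C1/C2 renormalization-transformation line).  Rows served (support): `C2.Eq4.17` of `HOME/lit-balaban-r18/ROWS-C2.md` (owner r18;
one step = r18's `isRT311_blockGauge`) and `C2.Eq5.2.9` of `HOME/lit-balaban-r16/ROWS-C2-part2.md` (owner r16; typed `Invariant529`).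

THE PRINTED TEXT.  p. 277 [PDF 21], (4.17): *"The second kind of gauge invariance is called block field gauge invariance, and is
invariance under u_b → u_be^{−ie_k(∂λ)(b)}, φ(x) → e^{ie_kλ(x)}, u_b^{(j)} → u_b^{(j)} exp[−ie_kL^jη(∂^{L^jη}Q′*_{k−j}λ)(b)], if b ∈ Λ₁^{(j)*c},
u_b^{(j)} → u_b^{(j)}, otherwise, (4.17) for λ a function on T₁^{(k)}. Here Q′_k denotes the averaging operator for real-valued functions on
sites. The dependence of u_k and u and the u^{(j)} is such that the above transformations induce the gauge transformation u_{k,b} →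
u_{k,b} exp[−ie_kη(∂^ηQ′*_kλ)], and thus we have invariance in the previous sense. Here, however, the variables u and u^{(j)} are also
transformed, but in a way that does not affect the δ-functions giving the axial gauge conditions and gauge field renormalization
transformations."*  p. 279 [PDF 23], (5.2.9): *"Let us remark that having imposed the axial gauge conditions, we resign from all but the
following restricted block field gauge invariance: ψ_y → ψ_y e^{ie_kλ(y)}, φ_x → φ_x e^{ie_k(Q′*λ)(x)}, v_{b′} → v_{b′} e^{−ie_kL(∂^Lλ)(b′)},
u_b → u_b e^{−ie_k(∂Q′*λ)(b)}, u_b^{(j)} → u_b^{(j)} exp(−ie_kL^jη(∂^{L^jη}Q′*_{k−j+1}λ)(b)), b ∈ Λ₁^{(j)*c} only. (5.2.9) … This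
restricted gauge invariance we intend to preserve in all subsequent operations."*

WHAT IS PROVED, and how (group-level reading of (4.17)/(5.2.9), as in r18's `BIJ88BlockGauge417`: `λ` on the block lattice
`T_L^{(k+1)}` ↔ `g = e^{ie_kλ} : T_L^{(k+1)} → U(1)`; `Q′*λ` = the pull-back to blocks, so `u`, `φ` on `T₁^{(k)}` are transformed by the
block-constant `g∘blockOf` — r18's `blockGaugeUj_eq_cfg_gaugeAct`, `bgGaugePhi_eq_twist`; `v ↦ v^g`, `ψ ↦ gψ`).  HYPOTHESES on the data of
(5.1.1) (file 1's `IsRT511 terms Qu Qφ a ρ′ ρ̃`): the gauge-field block average is block-gauge COVARIANT, `Q(u^{g∘y}) = (Qu)^g` (for the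
printed (2.10) of [2] this is r18's `qU_gaugeAct_blockConst`; p. 277 *"does not affect the δ-functions giving the … gauge field
renormalization transformations"*: `δ(v/Qu)` is invariant when `v` and `u` move together); for every term `t` and every `g` a measurable
equivalence `τ_t(g)` of the earlier fields preserving `Π𝒟u^{(j)}` (the fifth map of (5.2.9)/(4.17); shape `BIJ88RT51NoChange.mulRightPrev`)
such that `ρ′_t(τ_t(g){u^{(j)}}, u^{g∘y}, (g∘y)φ) = ρ′_t({u^{(j)}}, u, φ)` (*"and thus we have invariance in the previous sense"*) and the
background kernel is covariant, `Q_t(τ_t(g){u^{(j)}}, u^{g∘y}, (g∘y)φ) = g·Q_t({u^{(j)}}, u, φ)` (the induced transformation of `u_k`).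
* §1 `uIntegral_blockGauge`: the core computation for one term against ANY `u`-measure invariant under the block-constant gauge
  transformations — substitute `u → u^{g∘y}`, `{u^{(j)}} → τ_t(g){u^{(j)}}`, `φ → (g∘y)φ`, `ψ → gψ` (r18's `integral_comp_twist`, the
  rotation invariance of the `ψ`-Gaussian `gaussWeight_twist`), the test function absorbing the inverse transformation.
* §2 **`isRT511_blockGauge`** (`𝒟u`, r18's `integral_comp_gaugeAct`) and **`isRT511Ax_blockGauge`** (`𝒟u δ_{Ax}(u)`, r18's
  `integral_comp_gaugeAct_blockConst_axialMeasure`: *"does not affect the δ-functions giving the axial gauge conditions"*): for every `ρ̃`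
  satisfying (5.1.1) (resp. (5.1.1) with (5.1.4)) and every `g : T_L^{(k+1)} → U(1)`, `(v, ψ) ↦ ρ̃(v^g, gψ)` satisfies it too — with NO
  measurability or integrability hypothesis on `ρ′`, `ρ̃` (standing range `k + 1 ≤ m + K` only for the `δ_{Ax}` version).
* §3 Instances: `isRT511Ax_blockGauge_single` — one history-free term with the PRINTED `Qu`, `Q(u)φ` of [2] (r18's `qU`/`qCov`,
  covariance `qU_gaugeAct_blockConst`/`qCov_gaugeAct_blockConst`) and a jointly gauge-invariant `ρ₀` IS r18's `isRT311_blockGauge` read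
  through file 1's `isRT511Ax_single_iff_isRT311` (consistency, both directions available); `isRT511_blockGauge_mulRight`: the
  `𝒟u`-version with `τ_t(g) := mulRightPrev (w_t g)` for any prescription `w` (measure preservation automatic).
NOT DONE HERE (honest scope).  The specific factors `exp(−ie_kL^jη(∂^{L^jη}Q′*_{k−j+1}λ)(b))` on `Λ₁^{(j)*c}` and the verification that
the concrete `ρ′_k`, `u_k` of Sects. 4–5 have the assumed invariance/covariance (r18's `backgroundU_blockGauge(_iter)` covers the
background part of (4.2) for block-constant `λ`); almost-everywhere invariance of a CHOSEN version of `ρ̃` (one step: r18's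
`rt_blockGauge_ae_eq`); any bound.  Theorems only; re-declares nothing; imports file 2 (hence file 1; Literature + Mathlib); standard axioms.
-/

namespace Literature.MathematicalPhysics.QuantumFieldTheory.BalabanImbrieJaffe1984to88.BIJ88RT51BlockGauge

open Literature.MathematicalPhysics.QuantumFieldTheory.Balaban1983to89
open BIJ88Sect3Statements (U1 toC toC_one)
open BIJ85Sect1Model (HiggsField)
open BIJ85RT33 (JointInvariant twist twist_apply measurable_twist)
open BIJ88RenormTransf311 (axialMeasure gaussWeight IsRT311)
open BIJ85BlockAveragesTorus (qU qCov)
open BIJ88InductiveForm41 (Prev prevMeasure)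
open BIJ88BlockGauge417 (integral_comp_gaugeAct integral_comp_gaugeAct_blockConst_axialMeasure measurable_gaugeAct
  gaugeAct_inv_gaugeAct twist_inv_twist integral_comp_twist gaussWeight_twist qU_gaugeAct_blockConst qCov_gaugeAct_blockConst
  isRT311_blockGauge)
open BIJ88RT51GeneralStep (IsRT511 IsRT511Ax uIntegrand isRT511_iff isRT511Ax_iff isRT511Ax_single_iff_isRT311)
open BIJ88RT51NoChange (mulRightPrev measurePreserving_mulRightPrev)
open GaugeField (gaugeAct)
open scoped BigOperators ENNReal
open _root_.MeasureTheory _root_.MeasureTheory.Measure Complex Function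

noncomputable section

variable {P : Params} {k : ℕ}

/-! ## §1 The core substitution, for one term and any block-gauge invariant `u`-measure -/

/-- **One term of (5.1.1) under a block field gauge transformation** (the computation of r18's `isRT311_blockGauge`, with the earlier
fields): for a `u`-measure `μ` invariant under the block-constant gauge transformations `u ↦ u^{g∘y}`, block-gauge covariant `Qu`,
a `Π𝒟u^{(j)}`-preserving reparametrization `τ` with `ρ′(τ{u^{(j)}}, u^{g∘y}, (g∘y)φ) = ρ′` and `Q(τ{u^{(j)}}, u^{g∘y}, (g∘y)φ) = g·Q`, the
`μ`-integral of the `u`-integrand tested against `(v, ψ) ↦ t(v^{g⁻¹}, g⁻¹ψ)` equals the one tested against `t`.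
[cite: BalabanImbrieJaffe1988, (4.17) p.277] -/
theorem uIntegral_blockGauge {μ : Measure (GaugeField P k U1)} (g : GaugeTransf P (k+1) U1)
    (hμ : ∀ F : GaugeField P k U1 → ℂ, ∫ U, F (gaugeAct (fun x => g (blockOf x)) U) ∂μ = ∫ U, F U ∂μ)
    {Qu : GaugeField P k U1 → GaugeField P (k+1) U1} (hQu : ∀ U, Qu (gaugeAct (fun x => g (blockOf x)) U) = gaugeAct g (Qu U))
    {Qφ : Prev P k → GaugeField P k U1 → HiggsField P k → HiggsField P (k+1)} {a : ℝ}
    {ρ' : Prev P k → GaugeField P k U1 → HiggsField P k → ℂ}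
    (τ : Prev P k ≃ᵐ Prev P k) (hτ : MeasurePreserving τ (prevMeasure P k) (prevMeasure P k))
    (hρ : ∀ prev U φ, ρ' (τ prev) (gaugeAct (fun x => g (blockOf x)) U) (twist (fun x => g (blockOf x)) φ) = ρ' prev U φ)
    (hQφ : ∀ prev U φ,
      Qφ (τ prev) (gaugeAct (fun x => g (blockOf x)) U) (twist (fun x => g (blockOf x)) φ) = twist g (Qφ prev U φ))
    (t : GaugeField P (k+1) U1 × HiggsField P (k+1) → ℂ) :
    ∫ U, uIntegrand Qu Qφ a ρ' (fun z => t (gaugeAct (fun y => (g y)⁻¹) z.1, twist (fun y => (g y)⁻¹) z.2)) U ∂μ =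
      ∫ U, uIntegrand Qu Qφ a ρ' t U ∂μ := by
  simp only [uIntegrand]
  -- `u → u^{g∘y}` under `μ`; `Q(u^{g∘y}) = (Qu)^g` cancels the inverse transformation in the test function
  rw [← hμ (fun U => ∫ prev, ∫ φ, ∫ ψ, ρ' prev U φ * (gaussWeight a (Qφ prev U φ) ψ : ℂ) *
    t (gaugeAct (fun y => (g y)⁻¹) (Qu U), twist (fun y => (g y)⁻¹) ψ) ∂volume ∂volume ∂prevMeasure P k)]
  refine integral_congr_ae (ae_of_all _ fun U => ?_)
  simp only [hQu U, gaugeAct_inv_gaugeAct]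
  -- `{u^{(j)}} → τ{u^{(j)}}` under `Π𝒟u^{(j)}`
  rw [← hτ.integral_comp' (fun prev => ∫ φ, ∫ ψ, ρ' prev (gaugeAct (fun x => g (blockOf x)) U) φ *
    (gaussWeight a (Qφ prev (gaugeAct (fun x => g (blockOf x)) U) φ) ψ : ℂ) * t (Qu U, twist (fun y => (g y)⁻¹) ψ))]
  refine integral_congr_ae (ae_of_all _ fun prev => ?_)
  dsimp only
  -- `φ → (g∘y)φ` under `𝒟φ`
  rw [← integral_comp_twist (fun x => g (blockOf x)) (fun φ => ∫ ψ, ρ' (τ prev) (gaugeAct (fun x => g (blockOf x)) U) φ *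
    (gaussWeight a (Qφ (τ prev) (gaugeAct (fun x => g (blockOf x)) U) φ) ψ : ℂ) * t (Qu U, twist (fun y => (g y)⁻¹) ψ))]
  refine integral_congr_ae (ae_of_all _ fun φ => ?_)
  simp only [hρ prev U φ, hQφ prev U φ]
  -- `ψ → gψ` under `dψ`
  rw [← integral_comp_twist g (fun ψ => ρ' prev U φ * (gaussWeight a (twist g (Qφ prev U φ)) ψ : ℂ) *
    t (Qu U, twist (fun y => (g y)⁻¹) ψ))]
  simp only [gaussWeight_twist, twist_inv_twist]

/-- kernel: moving a block field gauge transformation from the density to the test function — `dv`, `dψ` are invariant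
(`∫dv∫dψ ρ̃(v^g, gψ) t(v, ψ) = ∫dv∫dψ ρ̃(v, ψ) t(v^{g⁻¹}, g⁻¹ψ)`; r18's step 1). [cite: BalabanImbrieJaffe1988, (4.17) p.277] -/
theorem integral_blockGauge_test (g : GaugeTransf P (k+1) U1) (ρL : GaugeField P (k+1) U1 → HiggsField P (k+1) → ℂ)
    (t : GaugeField P (k+1) U1 × HiggsField P (k+1) → ℂ) :
    ∫ v, ∫ ψ, ρL (gaugeAct g v) (twist g ψ) * t (v, ψ) ∂volume ∂fieldMeasure P (k+1) U1 =
      ∫ v, ∫ ψ, ρL v ψ * t (gaugeAct (fun y => (g y)⁻¹) v, twist (fun y => (g y)⁻¹) ψ) ∂volume ∂fieldMeasure P (k+1) U1 := by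
  rw [← integral_comp_gaugeAct g (fun v => ∫ ψ, ρL v ψ * t (gaugeAct (fun y => (g y)⁻¹) v, twist (fun y => (g y)⁻¹) ψ))]
  refine integral_congr_ae (ae_of_all _ fun v => ?_)
  simp only [gaugeAct_inv_gaugeAct]
  rw [← integral_comp_twist g (fun ψ => ρL (gaugeAct g v) ψ * t (v, twist (fun y => (g y)⁻¹) ψ))]
  simp only [twist_inv_twist]

/-- kernel: the block-gauge transformed test function is again bounded and measurable. [cite: BalabanImbrieJaffe1988, (4.17) p.277] -/
theorem test_blockGauge (g : GaugeTransf P (k+1) U1) {t : GaugeField P (k+1) U1 × HiggsField P (k+1) → ℂ} (ht : Measurable t)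
    (hb : ∃ C : ℝ, ∀ z, ‖t z‖ ≤ C) :
    Measurable (fun z : GaugeField P (k+1) U1 × HiggsField P (k+1) =>
        t (gaugeAct (fun y => (g y)⁻¹) z.1, twist (fun y => (g y)⁻¹) z.2)) ∧
      ∃ C : ℝ, ∀ z : GaugeField P (k+1) U1 × HiggsField P (k+1), ‖t (gaugeAct (fun y => (g y)⁻¹) z.1, twist (fun y => (g y)⁻¹) z.2)‖ ≤ C := by
  refine ⟨ht.comp (((measurable_gaugeAct _).comp measurable_fst).prodMk ((measurable_twist _).comp measurable_snd)), ?_⟩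
  obtain ⟨C, hC⟩ := hb
  exact ⟨C, fun z => hC _⟩

/-! ## §2 Block field gauge covariance of (5.1.1), with and without the axial gauge conditions -/

/-- **Block field gauge covariance of the general-step transformation (5.1.1)** ((4.17) p. 277 / (5.2.9) p. 279 *"This restricted
gauge invariance we intend to preserve in all subsequent operations"*, for the operation (5.1.1)): if `ρ̃` satisfies the typed
(5.1.1) `IsRT511 terms Qu Qφ a ρ′ ρ̃` with block-gauge covariant `Qu`, and for every term `t` and every `g : T_L^{(k+1)} → U(1)` a
`Π𝒟u^{(j)}`-preserving reparametrization `τ_t(g)` of the earlier fields leaves `ρ′_t` invariant and the background kernel `Q_t`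
covariant (jointly with `u ↦ u^{g∘y}`, `φ ↦ (g∘y)φ`), then `(v, ψ) ↦ ρ̃(v^g, gψ)` satisfies (5.1.1) for the same data.  No
measurability or integrability hypothesis on `ρ′`, `ρ̃`. [cite: BalabanImbrieJaffe1988, (4.17) p.277] -/
theorem isRT511_blockGauge {ι : Type*} {terms : Finset ι} {Qu : GaugeField P k U1 → GaugeField P (k+1) U1}
    (hQu : ∀ (g : GaugeTransf P (k+1) U1) U, Qu (gaugeAct (fun x => g (blockOf x)) U) = gaugeAct g (Qu U))
    {Qφ : ι → Prev P k → GaugeField P k U1 → HiggsField P k → HiggsField P (k+1)} {a : ℝ}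
    {ρ' : ι → Prev P k → GaugeField P k U1 → HiggsField P k → ℂ}
    (τ : ι → GaugeTransf P (k+1) U1 → Prev P k ≃ᵐ Prev P k)
    (hτ : ∀ t ∈ terms, ∀ g, MeasurePreserving (τ t g) (prevMeasure P k) (prevMeasure P k))
    (hρ : ∀ t ∈ terms, ∀ (g : GaugeTransf P (k+1) U1) prev U φ,
      ρ' t (τ t g prev) (gaugeAct (fun x => g (blockOf x)) U) (twist (fun x => g (blockOf x)) φ) = ρ' t prev U φ)
    (hQφ : ∀ t ∈ terms, ∀ (g : GaugeTransf P (k+1) U1) prev U φ,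
      Qφ t (τ t g prev) (gaugeAct (fun x => g (blockOf x)) U) (twist (fun x => g (blockOf x)) φ) = twist g (Qφ t prev U φ))
    {ρL : GaugeField P (k+1) U1 → HiggsField P (k+1) → ℂ} (h : IsRT511 terms Qu Qφ a ρ' ρL) (g : GaugeTransf P (k+1) U1) :
    IsRT511 terms Qu Qφ a ρ' (fun v ψ => ρL (gaugeAct g v) (twist g ψ)) := by
  rw [isRT511_iff] at h ⊢
  intro t ht hb
  obtain ⟨hmeas, hbdd⟩ := test_blockGauge g ht hb
  rw [integral_blockGauge_test g ρL t, h _ hmeas hbdd]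
  exact Finset.sum_congr rfl fun i hi =>
    uIntegral_blockGauge g (integral_comp_gaugeAct _) (hQu g) (τ i g) (hτ i hi g) (hρ i hi g) (hQφ i hi g) t

/-- **The same WITH the axial gauge conditions (5.1.4) inserted** (`IsRT511Ax`): the block-constant gauge transformations preserve
`∫𝒟u δ_{Ax}(u)(·)` (r18's `integral_comp_gaugeAct_blockConst_axialMeasure` — p. 277 *"does not affect the δ-functions giving the axial
gauge conditions"*; standing range `k + 1 ≤ m + K`). [cite: BalabanImbrieJaffe1988, (4.17) p.277] -/
theorem isRT511Ax_blockGauge (hk : k + 1 ≤ P.m + P.K) {ι : Type*} {terms : Finset ι}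
    {Qu : GaugeField P k U1 → GaugeField P (k+1) U1}
    (hQu : ∀ (g : GaugeTransf P (k+1) U1) U, Qu (gaugeAct (fun x => g (blockOf x)) U) = gaugeAct g (Qu U))
    {Qφ : ι → Prev P k → GaugeField P k U1 → HiggsField P k → HiggsField P (k+1)} {a : ℝ}
    {ρ' : ι → Prev P k → GaugeField P k U1 → HiggsField P k → ℂ}
    (τ : ι → GaugeTransf P (k+1) U1 → Prev P k ≃ᵐ Prev P k)
    (hτ : ∀ t ∈ terms, ∀ g, MeasurePreserving (τ t g) (prevMeasure P k) (prevMeasure P k))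
    (hρ : ∀ t ∈ terms, ∀ (g : GaugeTransf P (k+1) U1) prev U φ,
      ρ' t (τ t g prev) (gaugeAct (fun x => g (blockOf x)) U) (twist (fun x => g (blockOf x)) φ) = ρ' t prev U φ)
    (hQφ : ∀ t ∈ terms, ∀ (g : GaugeTransf P (k+1) U1) prev U φ,
      Qφ t (τ t g prev) (gaugeAct (fun x => g (blockOf x)) U) (twist (fun x => g (blockOf x)) φ) = twist g (Qφ t prev U φ))
    {ρL : GaugeField P (k+1) U1 → HiggsField P (k+1) → ℂ} (h : IsRT511Ax terms Qu Qφ a ρ' ρL) (g : GaugeTransf P (k+1) U1) :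
    IsRT511Ax terms Qu Qφ a ρ' (fun v ψ => ρL (gaugeAct g v) (twist g ψ)) := by
  rw [isRT511Ax_iff] at h ⊢
  intro t ht hb
  obtain ⟨hmeas, hbdd⟩ := test_blockGauge g ht hb
  rw [integral_blockGauge_test g ρL t, h _ hmeas hbdd]
  exact Finset.sum_congr rfl fun i hi =>
    uIntegral_blockGauge g (integral_comp_gaugeAct_blockConst_axialMeasure hk g) (hQu g) (τ i g) (hτ i hi g) (hρ i hi g)
      (hQφ i hi g) t

/-! ## §3 Instances -/

/-- **Consistency with r18's one-step theorem**: for ONE history-free term with the PRINTED block averages `Qu` (2.10), `Q(u)φ` (2.6) of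
[2] (r18's `qU`/`qCov`: covariance `qU_gaugeAct_blockConst`, `qCov_gaugeAct_blockConst`) and a jointly gauge-invariant `ρ₀`, the
`δ_{Ax}`-version gives back r18's `isRT311_blockGauge` through file 1's `isRT511Ax_single_iff_isRT311` (reparametrization `τ = id`).
[cite: BalabanImbrieJaffe1988, (4.17) p.277] -/
theorem isRT511Ax_blockGauge_single (hk : k + 1 ≤ P.m + P.K) {a : ℝ} {ρ₀ : GaugeField P k U1 → HiggsField P k → ℂ}
    (hρg : JointInvariant ρ₀) {ρL : GaugeField P (k+1) U1 → HiggsField P (k+1) → ℂ}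
    (h : IsRT511Ax (Finset.univ : Finset Unit) qU (fun _ _ => qCov) a (fun _ _ => ρ₀) ρL) (g : GaugeTransf P (k+1) U1) :
    IsRT511Ax (Finset.univ : Finset Unit) qU (fun _ _ => qCov) a (fun _ _ => ρ₀) (fun v ψ => ρL (gaugeAct g v) (twist g ψ)) :=
  isRT511Ax_blockGauge hk (qU_gaugeAct_blockConst hk) (fun _ _ => MeasurableEquiv.refl (Prev P k))
    (fun _ _ _ => MeasurePreserving.id _) (fun _ _ g' _ U φ => hρg (fun x => g' (blockOf x)) U φ)
    (fun _ _ g' _ U φ => qCov_gaugeAct_blockConst hk g' U φ) h g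

/-- kernel: the same statement obtained from r18's `isRT311_blockGauge` directly (both routes agree).
[cite: BalabanImbrieJaffe1988, (4.17) p.277] -/
theorem isRT511Ax_blockGauge_single' (hk : k + 1 ≤ P.m + P.K) {a : ℝ} {ρ₀ : GaugeField P k U1 → HiggsField P k → ℂ}
    (hρg : JointInvariant ρ₀) {ρL : GaugeField P (k+1) U1 → HiggsField P (k+1) → ℂ}
    (h : IsRT511Ax (Finset.univ : Finset Unit) qU (fun _ _ => qCov) a (fun _ _ => ρ₀) ρL) (g : GaugeTransf P (k+1) U1) :
    IsRT511Ax (Finset.univ : Finset Unit) qU (fun _ _ => qCov) a (fun _ _ => ρ₀) (fun v ψ => ρL (gaugeAct g v) (twist g ψ)) :=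
  (isRT511Ax_single_iff_isRT311 qU qCov a ρ₀ _).2
    (isRT311_blockGauge hk ((isRT511Ax_single_iff_isRT311 qU qCov a ρ₀ ρL).1 h) hρg g)

/-- **The `𝒟u`-version with the (4.17)-shaped reparametrization** `τ_t(g) := mulRightPrev (w_t(g))` (file 2: bondwise right
multiplication of the earlier fields by prescribed group elements; `Π𝒟u^{(j)}`-preserving for ANY prescription `w`): only the
invariance of `ρ′_t` and the covariance of `Q_t` remain as hypotheses. [cite: BalabanImbrieJaffe1988, (4.17) p.277] -/
theorem isRT511_blockGauge_mulRight {ι : Type*} {terms : Finset ι} {Qu : GaugeField P k U1 → GaugeField P (k+1) U1}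
    (hQu : ∀ (g : GaugeTransf P (k+1) U1) U, Qu (gaugeAct (fun x => g (blockOf x)) U) = gaugeAct g (Qu U))
    {Qφ : ι → Prev P k → GaugeField P k U1 → HiggsField P k → HiggsField P (k+1)} {a : ℝ}
    {ρ' : ι → Prev P k → GaugeField P k U1 → HiggsField P k → ℂ}
    (w : ι → GaugeTransf P (k+1) U1 → (i : Fin k) → PBond P i → U1)
    (hρ : ∀ t ∈ terms, ∀ (g : GaugeTransf P (k+1) U1) prev U φ,
      ρ' t (mulRightPrev (w t g) prev) (gaugeAct (fun x => g (blockOf x)) U) (twist (fun x => g (blockOf x)) φ) = ρ' t prev U φ)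
    (hQφ : ∀ t ∈ terms, ∀ (g : GaugeTransf P (k+1) U1) prev U φ,
      Qφ t (mulRightPrev (w t g) prev) (gaugeAct (fun x => g (blockOf x)) U) (twist (fun x => g (blockOf x)) φ) =
        twist g (Qφ t prev U φ))
    {ρL : GaugeField P (k+1) U1 → HiggsField P (k+1) → ℂ} (h : IsRT511 terms Qu Qφ a ρ' ρL) (g : GaugeTransf P (k+1) U1) :
    IsRT511 terms Qu Qφ a ρ' (fun v ψ => ρL (gaugeAct g v) (twist g ψ)) :=
  isRT511_blockGauge hQu (fun t g => mulRightPrev (w t g)) (fun t _ g => measurePreserving_mulRightPrev (w t g)) hρ hQφ h g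

end

end Literature.MathematicalPhysics.QuantumFieldTheory.BalabanImbrieJaffe1984to88.BIJ88RT51BlockGauge
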